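import Literature.AlgebraicGeometry.Frobenioids.NumberFieldLocalizationsAut
import Literature.AlgebraicGeometry.Frobenioids.NumberFieldLocalizationsFSMFFProofs
import Literature.AlgebraicGeometry.Frobenioids.NumberFieldLocalizationReconstruction
import Literature.AlgebraicGeometry.Frobenioids.NumberFieldLocalizationCategoriesFSMFF
import Literature.AlgebraicGeometry.Frobenioids.NumberFieldLocalizationsGlue
import Mathlib.GroupTheory.SpecificGroups.Cyclic.Basic
import HarnessLib

/-!
# Frobenioids II, Example 1.4 (iii): Proposition 1.5 applied to the concrete `E₀ → P₀`

Mochizuki, *The geometry of Frobenioids II: poly-Frobenioids*, Kyushu J. Math. **62** (2008)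
401–460, §1, Example 1.4 (iii) p. 13 [cite: MochizukiFrdII2008, Ex. 1.4 (iii) p.13]: "given a
connected, totally epimorphic category `P` and a functor `P → P₀`, one obtains a connected, totally
epimorphic category `E := P ×_{P₀} E₀` [cf. Prop. 1.5 (ii), (iii)] … If, moreover, `P` is of FSM-type,
then `E` is of FSMFF-type [cf. Prop. 1.5 (viii)] … if `P` is … slim, then so is `E` [cf. Prop. 1.5
(iv)]; if `P` is of strongly indissectible type, then so is `E` [cf. Prop. 1.5 (vii)]."

The statement file `NumberFieldLocalizationCategories.lean` (abc-iut-L1-t8) types this paragraph as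
the named statement `NFLocCat.ApplicationToPadicFrobenioids G D` for an ARBITRARY topological group
`G` and subgroup `D`. This PROOF-ONLY file assembles, for `G` PROFINITE (`[CompactSpace G]
[TotallyDisconnectedSpace G]`, as the printed `G = Gal(F̃/F)` is), the generic Proposition 1.5
theorems (t8: `NumberFieldLocalizations*.lean`; (viii): `NumberFieldLocalizationsFSMFFProofs.lean`)
over the Example 1.4 (ii) facts (abc-iut-L1-d9: `NumberFieldLocalizationCategoriesProofs/FSMFF.lean`)
and the reconstruction bijection for the concrete functor (`NumberFieldLocalizationReconstruction.lean`):

* `application_of_profinite` — the conjuncts "connected", "totally epimorphic", "FSM-type ⇒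
  FSMFF-type", "slim ⇒ slim" of the typed statement, verbatim, under the profinite hypothesis;
* `isOfStronglyIndissectibleType_of_fst` — the last conjunct ("strongly indissectible type")
  under the additional non-degeneracy hypothesis `hne` of t8's repaired Prop. 1.5 (vii)
  (`NFLoc.dissectible_iff_fst`): an object of `E` is non-initial iff its projection to `P` is.

Also DISCHARGED here: t8's repaired statement `NFLocCat.ApplicationToPadicFrobenioidsRepaired`
(RULING E14-iii; `applicationToPadicFrobenioidsRepaired_holds`) and the assembly obligations of
`NumberFieldLocalizationsGlue.lean`: `toP₀HomReconstruction_holds` (every topological group),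
`toP₀EssSurj_of_profinite`, `pHasTrivialFactorizations_holds` (`D_v` trivial or of prime order: every
object of `P₀` is then a point or a free orbit, so in a composable pair one factor is bijective).

NOT here (recorded, no side taken): the typed `ApplicationToPadicFrobenioids` itself is not
discharged — over a non-profinite `G` its connectedness clause fails (no object of `E₀` lies over some
objects of `P₀`), and its last conjunct fails without `hne` in the degenerate case `D = 1`, `P` the
one-morphism category (then `E ≃` the poset of open subgroups of `G`, whose top object is strongly
dissected by two incomparable open subgroups), exactly as t8's erratum note on Prop. 1.5 (vii).
No new definitions; nothing here bears on [IUTchIII].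
-/

namespace Literature.AlgebraicGeometry.Frobenioids

namespace NFLocCat

open CategoryTheory

universe v' u' u

variable {G : Type u} [Group G] [TopologicalSpace G] [IsTopologicalGroup G] (D : Subgroup G)

/-- **Example 1.4 (iii)** (FrdII p. 13) for profinite `G`: for a connected, totally epimorphic
category `P` with a functor `P → P₀`, the categorical fiber product `E = P ×_{P₀} E₀` is connected
and totally epimorphic [Prop. 1.5 (ii), (iii)]; if `P` is of FSM-type then `E` is of FSMFF-type
[Prop. 1.5 (viii)]; if `P` is slim then so is `E` [Prop. 1.5 (iv)] — the first four conjuncts of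
`NFLocCat.ApplicationToPadicFrobenioids`, verbatim. [cite: MochizukiFrdII2008, Ex. 1.4 (iii) p.13] -/
theorem application_of_profinite [CompactSpace G] [TotallyDisconnectedSpace G]
    {P : Type u'} [Category.{v'} P] (Φ : P ⥤ PCat G D) (hPc : IsConnected P)
    (hPt : IsTotallyEpimorphic P) :
    IsConnected (CFP Φ (toP₀ G D)) ∧ IsTotallyEpimorphic (CFP Φ (toP₀ G D)) ∧
      (IsOfFSMType P → IsOfFSMFFType (CFP Φ (toP₀ G D))) ∧
      (IsSlim P → IsSlim (CFP Φ (toP₀ G D))) := by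
  haveI : (toP₀ G D).Faithful := toP₀Faithful_holds D
  haveI : (toP₀ G D).EssSurj := essSurj_of_isArrowwiseEssSurj _ (toP₀ArrowwiseEssSurj_holds D)
  have h : NFLoc.HomReconstruction (toP₀ G D) := homReconstruction_toP₀ G D
  exact ⟨NFLoc.isConnected_of_isConnected_fst h hPc,
    NFLoc.isTotallyEpimorphic_of_fst hPt (eTotallyEpimorphic_holds D),
    fun hP => NFLoc.FSMFFOfFSMType_holds Φ (toP₀ G D) inferInstance inferInstance h
      (pTotallyEpimorphic_holds D) (eFSMFF_holds D) hP hPt,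
    fun hP => NFLoc.isSlim_of_isSlim_fst h hP⟩

/-- **Example 1.4 (iii)**, last clause (FrdII p. 13: "if `P` is of strongly indissectible type,
then so is `E` [cf. Proposition 1.5, (vii)]"), for profinite `G` and under the non-degeneracy
hypothesis `hne` of the repaired Prop. 1.5 (vii) (an object of `E` is non-initial iff its projection
is): a weak dissection of an object of `E` would project to one of its projection.
[cite: MochizukiFrdII2008, Ex. 1.4 (iii) p.13] -/
theorem isOfStronglyIndissectibleType_of_fst [CompactSpace G] [TotallyDisconnectedSpace G]
    {P : Type u'} [Category.{v'} P] (Φ : P ⥤ PCat G D)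
    (hne : ∀ Y : CFP Φ (toP₀ G D), IsNonemptyObj Y ↔ IsNonemptyObj Y.fst)
    (hP : IsOfStronglyIndissectibleType P) : IsOfStronglyIndissectibleType (CFP Φ (toP₀ G D)) := by
  haveI : (toP₀ G D).Faithful := toP₀Faithful_holds D
  haveI : (toP₀ G D).EssSurj := essSurj_of_isArrowwiseEssSurj _ (toP₀ArrowwiseEssSurj_holds D)
  have h : NFLoc.HomReconstruction (toP₀ G D) := homReconstruction_toP₀ G D
  exact ⟨fun X hX => hP.isStronglyIndissectible X.fst (NFLoc.isWeaklyDissectible_fst h hne hX)⟩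

/-! ### The assembly obligations of `NumberFieldLocalizationsGlue.lean` -/

variable (G) in
/-- OBLIGATION `ToP₀HomReconstruction` of `NumberFieldLocalizationsGlue.lean`, DISCHARGED for every
topological group (Prop. 1.5 (i), base case). [cite: MochizukiFrdII2008, Prop. 1.5 (i) p.14] -/
theorem toP₀HomReconstruction_holds : ToP₀HomReconstruction G D := homReconstruction_toP₀ G D

variable (G) in
/-- OBLIGATION `ToP₀EssSurj` of `NumberFieldLocalizationsGlue.lean`, DISCHARGED for profinite `G`
(via abc-iut-L1-d9's arrow-wise essential surjectivity). [cite: MochizukiFrdII2008, Ex. 1.4 (ii) p.13] -/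
theorem toP₀EssSurj_of_profinite [CompactSpace G] [TotallyDisconnectedSpace G] : ToP₀EssSurj G D :=
  essSurj_of_isArrowwiseEssSurj _ (toP₀ArrowwiseEssSurj_holds D)

/-- In `P₀ = B(D)⁰` a morphism out of a one-point object is an isomorphism (its target, a single orbit
containing a fixed point, is a point). [cite: MochizukiFrdII2008, Prop. 1.5 (ix) p.15] -/
theorem isIso_of_subsingleton {M B : PCat G D} (α : M ⟶ B) (m : M.obj.obj.V)
    (hM : ∀ m' : M.obj.obj.V, m' = m) : IsIso α := by
  have hsurj : Function.Surjective α.hom.hom.hom :=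
    BCat.surjective_of_isConnectedObj α.hom m B.property
  have hinj : Function.Injective α.hom.hom.hom := fun x y _ => (hM x).trans (hM y).symm
  haveI : IsIso α.hom := BCat.isIso_of_bijective α.hom ⟨hinj, hsurj⟩
  exact (ObjectProperty.isIso_hom_iff α).mp inferInstance

variable (G) in
/-- OBLIGATION `PHasTrivialFactorizations` of `NumberFieldLocalizationsGlue.lean`, DISCHARGED: if
`D_v` is trivial or of prime order, then in every composable pair `β : A → M`, `α : M → B` of
`P₀ = B(D_v)⁰` one factor is an isomorphism — `M` is a point (then `α` is bijective) or a free orbit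
(then the stabilisers in `A` are trivial too and `β` is bijective) (FrdII p. 15).
[cite: MochizukiFrdII2008, Prop. 1.5 (ix) p.15] -/
theorem pHasTrivialFactorizations_holds : PHasTrivialFactorizations G D := by
  intro hD
  refine ⟨fun {A M B} β α => ?_⟩
  obtain ⟨m⟩ := BCat.nonempty_of_isNonemptyObj _ M.property.1
  obtain ⟨a⟩ := BCat.nonempty_of_isNonemptyObj _ A.property.1
  by_cases hM : ∀ m' : M.obj.obj.V, m' = m
  · exact Or.inl (isIso_of_subsingleton D α m hM)
  · right
    -- `A` is a single orbit with trivial stabilisers, so `β` is injective; it is surjective anyway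
    have htrA := BCat.exists_smul_eq_of_isConnectedObj A.obj A.property a
    have htrM := BCat.exists_smul_eq_of_isConnectedObj M.obj M.property (β.hom.hom.hom a)
    have hsurj : Function.Surjective β.hom.hom.hom :=
      BCat.surjective_of_isConnectedObj β.hom a M.property
    -- the stabiliser of `β(a)` in `D` is trivial: else all of `D` fixes `β(a)` and `M = {β(a)}`
    have hstab : MulAction.stabilizer D (β.hom.hom.hom a) = ⊥ := by
      have key : MulAction.stabilizer D (β.hom.hom.hom a) = ⊤ → False := fun h => hM fun m' => by
        have hM' : ∀ m'' : M.obj.obj.V, m'' = β.hom.hom.hom a := fun m'' => by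
          obtain ⟨d, rfl⟩ := htrM m''
          have hd : d ∈ MulAction.stabilizer D (β.hom.hom.hom a) := by
            rw [h]; exact Subgroup.mem_top d
          exact MulAction.mem_stabilizer_iff.mp hd
        rw [hM' m', hM' m]
      rcases hD with hbot | hprime
      · subst hbot
        exact Subsingleton.elim _ _
      · haveI : Fact (Nat.card D).Prime := ⟨hprime⟩
        exact ((MulAction.stabilizer (↥D) (β.hom.hom.hom a)).eq_bot_or_eq_top_of_prime_card).resolve_right
          key
    have hinj : Function.Injective β.hom.hom.hom :=
      BCat.injective_of_stabilizer_le β.hom a htrA (by rw [hstab]; exact bot_le)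
    haveI : IsIso β.hom := BCat.isIso_of_bijective β.hom ⟨hinj, hsurj⟩
    exact (ObjectProperty.isIso_hom_iff β).mp inferInstance

end NFLocCat

/-! ### The repaired Example 1.4 (iii) -/

namespace NFLocCat

universe v'' u'' u₃

/-- **Example 1.4 (iii)** in the repaired, antecedent-carrying form `ApplicationToPadicFrobenioidsRepaired`
typed by abc-iut-L1-t8 (RULING E14-iii), DISCHARGED: the profinite hypotheses are handed to
`application_of_profinite` and `isOfStronglyIndissectibleType_of_fst`.
[cite: MochizukiFrdII2008, Ex. 1.4 (iii) p.13] -/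
theorem applicationToPadicFrobenioidsRepaired_holds {G : Type u₃} [Group G] [TopologicalSpace G]
    (D : Subgroup G) : ApplicationToPadicFrobenioidsRepaired.{v'', u''} G D := by
  intro hG hC hT P _ Φ hPc hPt
  haveI := hG; haveI := hC; haveI := hT
  exact ⟨application_of_profinite D Φ hPc hPt, fun hne hP => isOfStronglyIndissectibleType_of_fst D Φ hne hP⟩

end NFLocCat

end Literature.AlgebraicGeometry.Frobenioids
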